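import Summits.FinalStateConjecture.FinalStateConjecture.Theorems.PhotonSphereChannelsDarkFutureDefs
import Summits.FinalStateConjecture.FinalStateConjecture.Theorems.PhotonSphereChannelsChannelsResolveTameDevelopmentsRHullTrimming
import Summits.FinalStateConjecture.FinalStateConjecture.Theorems.PhotonSphereChannelsChannelsResolveTameDevelopmentsRSchwarzschildEndFar
import Summits.FinalStateConjecture.FinalStateConjecture.Theorems.PhotonSphereChannelsChannelsResolveTameDevelopmentsRSchwarzschildEndHorizon
import HarnessLib

/-!
# Crux `ChannelsResolveTameDevelopmentsR` (K2R-T2, stmt-FinalStateConjecture-17430), line `dark-future-exactness`,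
# stub P″ `stub_hullNearKerrIsSlabClose` (Reshape 2: the producer answers with a REPRESENTATIVE) —
# the canonical-representative CUT of P″, the free CLASS RELAXATION P‴, and the slab certificate of the
# exact Schwarzschild end (anti-vacuity of `IsSlabClose` from every depth of the carrier, drift `≤ 1`)

Over the landed vocabulary `Theorems/PhotonSphereChannelsDarkFutureDefs.lean` (`IsSlabClose … ρ …`,
`IsExteriorWindowClose`, `IsHorizonHullElement`, `penetratingBackground`), the window/trimming/re-clocking API of
`…RHullTrimming.lean` and the exact Schwarzschild end of `…RSchwarzschildEndFar/Horizon.lean`. Sorry-free, no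
definitions, no named facts.

* §1 `Schw.isSlabClose_of_far` — **the inclusion of the Kerr–Schild region `{r > ρ}` into the Schwarzschild patch
  `Kerr.spacetime M 0 r₁` is a slab chart with tolerance `δ = 0`**, at every order `k`, every weight `β`, from EVERY
  depth `ρ ∈ [r₁, 2M]` reached by the carrier, for every end datum whose far chart is the inclusion and whose clock is
  a stationary radial clock `x⁰ + F(r)`, at every epoch `c` with `|F(r) − c| ≤ 1` on the exterior `{r > 2M}` (the
  unit clock-epoch `{|clock − c| < 1} ∩ {r > 2M}` then lies in the chart slab `{|x⁰| < 2}`): the positive side of the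
  wave-2 drift boundary (`…RHullTrimming` §3: drift `> 2` defeats every slab chart) and the anti-vacuity certificate of
  the hypothesis `IsSlabClose` of the bridge B′ and of the conclusion of the producer P″ on the one certified
  horizon-carrying end of the tree (`Schw.isSlabClose_of_far_mono`: any `δ ≥ 0`; `Schw.isSilent_isSlabClose_of_far`:
  together with silence of the end).
* §2 `hullNearKerrIsSlabClose_along_of_canonical`, `hullNearKerrIsSlabClose_of_canonical` — **the cut of P″ into
  its two honest halves** (pure logic): (C1) CANONICAL REPRESENTATIVES — every horizon-hull element `(𝓢, E, p)` along
  `γ` has a canonical sibling `(𝓢', E', p')` along `γ` in the same class into which its exterior windows pass UP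
  (`IsExteriorWindowClose 𝓢 E … → IsExteriorWindowClose 𝓢' E' …`) and from whose d.o.c. exact-Kerr-ness passes DOWN
  (`IsKerrDoc 𝓢' E'.doc M a → IsKerrDoc 𝓢 E.doc M a`) — meant: the development's maximal limit along the same
  subsequence with the producer's negligible-drift clock, into which the input embeds isometrically with d.o.c. onto
  d.o.c.; (C2) CANONICAL SLAB-CLOSENESS — the wave-1 producer P′ RESTRICTED to canonical elements (uniform pinned
  depth, red-shift/Cauchy stability of the collar, far alignment below the mass order, interpolation). The predicate
  `Canon` is a parameter: C1 ∧ C2 for ANY `Canon` give P″ verbatim.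
* §3 `hullNearKerrIsSlabClose_relaxed_of`, `hullNearKerrIsSlabClose_relaxed_along_of_canonical` — **the class
  relaxation P‴** (the producer announces, together with the depth `ρ`, the CLASS `(Λ', r₀')` of its representative):
  P″ ⇒ P‴ (take `Λ' = Λ`), and the same cut proves P‴ from C1‴ ∧ C2‴ where the canonical sibling may live in the
  producer's class. Why (stub-worker P″, wave 3, `work/stubs/w3_stub_hullNearKerrIsSlabClose.md` §2(b)): in P″ the
  class `Λ` is ∀-bound and certified only by the INPUT's accidental end structure (far chart, clock), so the
  representative — which must re-clock to drift `≤ 2` — has to win a clock-optimality game at every order `k`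
  (`sup` of the `C^k` deviation of clock-adapted balls); at order `1` the game is won by zero-drift clocks (for a
  foliation `τ = v − G(r)` of Schwarzschild with tick rate `ν`, `N·K_θ̂θ̂ = 1/(4M·G'·ν)` at the horizon with
  `G'ν² ≤ 1` forced by `N² ≥ 1/2`, and eternity `v_H(c) ≤ c + A` forces horizon crossings with `G' ≤ 1 + o(1)`, so
  every admissible eternal clock has a ball with `N·K_θ̂θ̂ ≥ (1 − o(1))/(4M)`, attained by the Kerr–Schild slope
  `G' = 1` hugging `N² = 1/2`, drift `≈ 0`), at orders `≥ 2` it is unverified; P‴ removes the game and composes with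
  B′ by the same three lines of logic (checked in the worker's scratch file, B′ being a neighbour).

References: M. Dafermos, J. Luk, arXiv:1710.01722, §1.2.1 and Conjecture 1 [DafermosLuk2017]; S. Klainerman,
J. Szeftel, PAMQ 19 (2023), §3.1.1 [KlainermanSzeftel2023]; M. Dafermos, I. Rodnianski, arXiv:0811.0354, §5.1
and §7.1 [DafermosRodnianski2008]; K. Martel, E. Poisson, Am. J. Phys. 69 (2001) 476, §II [MartelPoisson2001];
M. T. Anderson, arXiv:gr-qc/0208079, Def. 1.1 [Anderson2004]; R. M. Wald, *General Relativity* (1984), §12.1 [Wald1984].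
-/

noncomputable section

-- the operator-norm instance on `E4 →L[ℝ] E4 →L[ℝ] ℝ` needs one more level of pending
-- instance problems than the default (as in `PhotonSphereChannelsDarkFutureDefs.lean`)
set_option maxSynthPendingDepth 3
-- every `Summit.FinalStateConjecture.FinalStateConjecture.…` name repeats the summit = sub-problem segment (D-0017 layout)
set_option linter.dupNamespace false

open Set Filter Function TopologicalSpace Manifold Bundle
open scoped Topology Manifold ContDiff ENNReal NNReal

/-! ### §1 The exact Schwarzschild end is slab-close with tolerance `0` from every depth of its carrier -/

namespace Summit.FinalStateConjecture.FinalStateConjecture.Theorems.TameHull.Schw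

open Literature.Geometry.Lorentzian LorentzianMetric
open Summit.FinalStateConjecture.FinalStateConjecture.Theorems.SeamedChartsExhaust.Negative

section Patch

-- `Kerr.spacetime` takes the instance hypothesis `[Kerr.Facts]` (all fields proved in the tree); kept as a
-- hypothesis, as in `…RSchwarzschildEndFar.lean`.
variable [Kerr.Facts] {M r₁ : ℝ} {hM : 0 ≤ M} (E : EndDatum (Kerr.spacetime M 0 r₁ hM))

/-- **The exact Schwarzschild end is slab-close to Kerr `(M, 0)` with tolerance `δ = 0`, from every depth
`ρ ∈ [r₁, 2M]` of its carrier, at every order and weight, at every epoch `c` within `1` of its clock profile on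
the exterior.** On the horizon-penetrating patch `Kerr.spacetime M 0 r₁` (`0 < r₁ ≤ 2M`) let `E` be an end datum
whose far chart is the inclusion of the far cylinder (`E.R ≥ 2M`) and whose clock is `x⁰ + F(r)`. If
`|F(r) − c| ≤ 1` for `r > 2M`, then the inclusion `Ψ : Kerr.region 0 ρ = {r > ρ} ↪ {r > r₁}` witnesses
`IsSlabClose (Kerr.spacetime M 0 r₁) E M 0 ρ k β c 0`: it is injective and smooth, maps `{r > 2M = r₊}` into
`E.doc = {r > 2M}`, pulls `g_{M,0}` back to itself (`Ψ^* g − g_{M,0} = 0`, so every weighted `C^k` bound is `0`),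
maps `∂_{t*}` to a future vector on `{r > 2M}`, and COVERS the unit clock-epoch: a point `q` of the d.o.c. with
`|q⁰ + F(r(q)) − c| < 1` has `|q⁰| < 2`. The drift bound `1` is the positive side of the coverage obstruction of
`…RHullTrimming` §3 (drift `> 2` ⇒ no slab chart). Klainerman–Szeftel 2023, §3.1.1 (the penetrating slab).
[cite: KlainermanSzeftel2023, §3.1.1] -/
theorem isSlabClose_of_far (hfar : ∀ y, (E.far y).1 = y.1) (hM' : 0 < M) (hr₁ : 0 < r₁) (hr₂ : r₁ ≤ 2 * M)
    (hER : 2 * M ≤ E.R) {F : ℝ → ℝ} (hclock : ∀ x, E.clock x = x.1 0 + F (Kerr.radius 0 x.1)) {c : ℝ}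
    (hFc : ∀ r, 2 * M < r → |F r - c| ≤ 1) {ρ : ℝ} (hρ₁ : r₁ ≤ ρ) (hρ₂ : ρ ≤ 2 * M) (k : ℕ) (β : ℝ) :
    IsSlabClose (Kerr.spacetime M 0 r₁ hM) E M 0 ρ k β c 0 := by
  have hle : Kerr.region (0 : ℝ) ρ ≤ Kerr.region 0 r₁ := Kerr.region_mono 0 hρ₁
  set Ψ : Kerr.region (0 : ℝ) ρ → (Kerr.spacetime M 0 r₁ hM).carrier := Opens.inclusion hle with hΨ
  have hdΨ : ∀ (x : Kerr.region (0 : ℝ) ρ) (v : E4), mfderiv 𝓘(ℝ, E4) (𝓡 4) Ψ x v = v :=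
    fun x v ↦ OpensChart.mfderiv_inclusion_apply hle x v
  have hrp : Kerr.rPlus M 0 = 2 * M := Kerr.rPlus_zero_right hM
  have hdoc : E.doc = {x | 2 * M < Kerr.radius 0 x.1} := doc_eq_of_far E hfar hM' hr₁ hr₂ hER
  have hdev : ∀ x, (Kerr.spacetime M 0 r₁ hM).deviation (penetratingBackground M 0 ρ) Ψ x = 0 := by
    intro x
    ext v w
    rw [Spacetime.deviation_apply]
    erw [hdΨ x v, hdΨ x w]
    exact sub_self _
  refine ⟨Ψ, fun a b h ↦ Subtype.ext (congrArg Subtype.val h :), contMDiff_inclusion hle, ?_, ?_, ?_, ?_⟩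
  · -- the exterior part of the chart lies in the d.o.c.
    intro x hx
    rw [hdoc]
    rw [hrp] at hx
    exact hx
  · -- the unit clock-epoch `c` of the d.o.c. is covered by the slab `{r > 2M, |x⁰| < 2}`
    intro q hq hqc
    rw [hdoc] at hq
    have hq' : 2 * M < Kerr.radius 0 q.1 := hq
    have hqρ : q.1 ∈ Kerr.region (0 : ℝ) ρ :=
      Kerr.mem_region.2 ((max_le hρ₂ (by linarith)).trans_lt hq')
    refine ⟨⟨q.1, hqρ⟩, by rw [hrp]; exact hq', ?_, Subtype.ext rfl⟩
    rw [hclock] at hqc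
    have h1 : |F (Kerr.radius 0 q.1) - c| ≤ 1 := hFc _ hq'
    have h2 := abs_sub (q.1 0 + F (Kerr.radius 0 q.1) - c) (F (Kerr.radius 0 q.1) - c)
    have e : q.1 0 + F (Kerr.radius 0 q.1) - c - (F (Kerr.radius 0 q.1) - c) = q.1 0 := by ring
    rw [e] at h2
    show |(q.1 : E4) 0| < 2
    linarith
  · -- the deviation from `g_{M,0}` vanishes identically, hence so does every weighted `C^k` bound
    intro m _ x _
    rw [deviationExtend_eq_zero hdev, iteratedFDeriv_zero (𝕜 := ℝ)]
    simp
  · -- `Ψ_* ∂_{t*} = ∂_{t*}` is future-directed on `{r > 2M}`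
    intro x hx
    rw [hdΨ]
    exact Schw.isFutureDirected_e0 (hM := hM) (Ψ x) hx

/-- **Monotone form**: the same end is `δ`-slab-close for every `δ ≥ 0` (from every depth `ρ ∈ [r₁, 2M]`, at every
order, weight and admissible epoch). [cite: KlainermanSzeftel2023, §3.1.1] -/
theorem isSlabClose_of_far_mono (hfar : ∀ y, (E.far y).1 = y.1) (hM' : 0 < M) (hr₁ : 0 < r₁) (hr₂ : r₁ ≤ 2 * M)
    (hER : 2 * M ≤ E.R) {F : ℝ → ℝ} (hclock : ∀ x, E.clock x = x.1 0 + F (Kerr.radius 0 x.1)) {c : ℝ}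
    (hFc : ∀ r, 2 * M < r → |F r - c| ≤ 1) {ρ : ℝ} (hρ₁ : r₁ ≤ ρ) (hρ₂ : ρ ≤ 2 * M) (k : ℕ) (β : ℝ) {δ : ℝ}
    (hδ : 0 ≤ δ) : IsSlabClose (Kerr.spacetime M 0 r₁ hM) E M 0 ρ k β c δ :=
  (isSlabClose_of_far E hfar hM' hr₁ hr₂ hER hclock hFc hρ₁ hρ₂ k β).mono hδ

/-- **The hypothesis block of the bridge B′ is inhabited on the horizon side, up to tameness of the balls**: the
Schwarzschild end with inclusion far chart, reference mass `M` and a small-drift stationary radial clock is SILENT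
(`…RSchwarzschildEndFar/Horizon`) and `δ`-slab-close to the sub-extremal Kerr `(M, 0)` from every depth of its
carrier, for every `δ ≥ 0`, order, weight and admissible epoch — and its d.o.c. IS an exact Kerr `(M, 0)` exterior
(B′'s conclusion). (Class membership `IsTameClass` is file IV of the Schwarzschild end.) [cite: DafermosLuk2017, Conjecture 1] -/
theorem isSilent_isSlabClose_of_far (hfar : ∀ y, (E.far y).1 = y.1) (hEM : E.M = M) (hM' : 0 < M) (hr₁ : 0 < r₁)
    (hr₂ : r₁ ≤ 2 * M) (hER : 2 * M ≤ E.R) {F : ℝ → ℝ} (hF : ContDiff ℝ ∞ F)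
    (hclock : ∀ x, E.clock x = x.1 0 + F (Kerr.radius 0 x.1)) {c : ℝ} (hFc : ∀ r, 2 * M < r → |F r - c| ≤ 1) :
    E.IsSilent ∧ IsKerrDoc (Kerr.spacetime M 0 r₁ hM) E.doc M 0 ∧
      ∀ ρ : ℝ, r₁ ≤ ρ → ρ ≤ 2 * M → ∀ (k : ℕ) (β : ℝ), ∀ δ ≥ (0 : ℝ),
        IsSlabClose (Kerr.spacetime M 0 r₁ hM) E M 0 ρ k β c δ :=
  ⟨isSilent_of_horizon_eq E hM' (horizon_eq_of_far E hfar hM' hr₁ hr₂ hER) hF hclock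
      (isNonRadiating_of_far E hfar hEM),
    isKerrDoc_doc_of_far E hfar hM' hr₁ hr₂ hER,
    fun _ hρ₁ hρ₂ k β _ hδ ↦ isSlabClose_of_far_mono E hfar hM' hr₁ hr₂ hER hclock hFc hρ₁ hρ₂ k β hδ⟩

/-- **Registered form (sub-goal `schwarzschild_slabClose` of stmt-FinalStateConjecture-17430): the exact Schwarzschild end
with inclusion far chart and a stationary radial clock of exterior drift `≤ 1` about the epoch `c` is `δ`-slab-close
to Kerr `(M, 0)` for every `δ ≥ 0`, from every depth `ρ ∈ [r₁, 2M]` of its carrier, at every order and weight.**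
[cite: KlainermanSzeftel2023, §3.1.1] -/
theorem schwarzschild_slabClose : ∀ (E : EndDatum (Kerr.spacetime M 0 r₁ hM)), (∀ y, (E.far y).1 = y.1) → 0 < M → 0 < r₁ → r₁ ≤ 2 * M → 2 * M ≤ E.R → ∀ {F : ℝ → ℝ}, (∀ x, E.clock x = x.1 0 + F (Kerr.radius 0 x.1)) → ∀ {c : ℝ}, (∀ r, 2 * M < r → |F r - c| ≤ 1) → ∀ {ρ : ℝ}, r₁ ≤ ρ → ρ ≤ 2 * M → ∀ (k : ℕ) (β : ℝ), ∀ δ ≥ (0 : ℝ), IsSlabClose (Kerr.spacetime M 0 r₁ hM) E M 0 ρ k β c δ :=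
  fun E hfar hM' hr₁ hr₂ hER _ hclock _ hFc _ hρ₁ hρ₂ k β _ hδ ↦
    isSlabClose_of_far_mono E hfar hM' hr₁ hr₂ hER hclock hFc hρ₁ hρ₂ k β hδ

end Patch

end Summit.FinalStateConjecture.FinalStateConjecture.Theorems.TameHull.Schw

/-! ### §2 The cut of P″: canonical representatives (C1) and canonical slab-closeness (C2) -/

namespace Summit.FinalStateConjecture.FinalStateConjecture.Theorems.DarkFuture

open Literature.Geometry.Lorentzian
open Summit.FinalStateConjecture.FinalStateConjecture.Theorems.TameHull

section Cut

variable {X : Type} [TopologicalSpace X] [ChartedSpace E3 X] [IsManifold (𝓡 3) ∞ X]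
  [T2Space X] [SecondCountableTopology X] [ConnectedSpace X] {D : InitialDataSet (𝓡 3) X}

omit [T2Space X] [SecondCountableTopology X] in
/-- **P″ along one generator path from its cut C1 ∧ C2** (pure logic). Fix a development, a class `(Λ, r₀)`, a
path `γ` and ANY predicate `Canon` on based ends. (C1) CANONICAL REPRESENTATIVES: every horizon-hull element
`(𝓢, E, p)` along `γ` has a sibling `(𝓢', E', p')` along `γ`, in the same class, which is canonical, into which
its exterior windows pass (`IsExteriorWindowClose 𝓢 E M a W η δ → IsExteriorWindowClose 𝓢' E' M a W η δ` for all
`M a W η δ` — the input embeds isometrically, d.o.c. into d.o.c.) and whose exact-Kerr d.o.c. transfers back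
(`IsKerrDoc 𝓢' E'.doc M'' a'' → IsKerrDoc 𝓢 E.doc M'' a''` — d.o.c. ONTO d.o.c.). (C2) CANONICAL SLAB-CLOSENESS:
the wave-1 producer P′ restricted to canonical elements (announced depth `ρ`, then for all `k, β < 2, ε` a window
size such that window-close canonical elements are `ε`-slab-close from depth `ρ` to an `ε`-near Kerr at some epoch).
Then the conclusion of P″ holds along `γ`: push the window up to the canonical sibling, apply C2, pull exact-Kerr-ness
down. [cite: DafermosLuk2017, §1.2.1] -/
theorem hullNearKerrIsSlabClose_along_of_canonical {𝒟 : VacuumCauchyDevelopment D} [𝒟.metric.HasLeviCivita]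
    {Λ : ℕ → ℝ≥0} {r₀ : ℝ} {γ : ℝ → 𝒟.carrier}
    (Canon : ∀ 𝓢 : Spacetime.{0} 4, EndDatum 𝓢 → 𝓢.carrier → Prop)
    (hC1 : ∀ (𝓢 : Spacetime.{0} 4) (E : EndDatum 𝓢) (p : 𝓢.carrier), IsHorizonHullElement 𝒟 Λ r₀ γ 𝓢 E p →
      ∃ (𝓢' : Spacetime.{0} 4) (E' : EndDatum 𝓢') (p' : 𝓢'.carrier),
        IsHorizonHullElement 𝒟 Λ r₀ γ 𝓢' E' p' ∧ Canon 𝓢' E' p' ∧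
          (∀ M a W η δ : ℝ, IsExteriorWindowClose 𝓢 E M a W η δ → IsExteriorWindowClose 𝓢' E' M a W η δ) ∧
            ∀ M'' a'' : ℝ, IsKerrDoc 𝓢' E'.doc M'' a'' → IsKerrDoc 𝓢 E.doc M'' a'')
    (hC2 : ∀ M a : ℝ, 0 < M → |a| < M → ∃ ρ : ℝ, Kerr.rMinus M a < ρ ∧ ρ < Kerr.rPlus M a ∧
      ∀ (k : ℕ) (β : ℝ), β < 2 → ∀ ε > (0 : ℝ), ∃ W η δ : ℝ, 0 < η ∧ 0 < δ ∧
        ∀ (𝓢' : Spacetime.{0} 4) (E' : EndDatum 𝓢') (p' : 𝓢'.carrier),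
          IsHorizonHullElement 𝒟 Λ r₀ γ 𝓢' E' p' → Canon 𝓢' E' p' → IsExteriorWindowClose 𝓢' E' M a W η δ →
            ∃ M' a' c : ℝ, |M' - M| + |a' - a| ≤ ε ∧ IsSlabClose 𝓢' E' M' a' ρ k β c ε) :
    ∀ M a : ℝ, 0 < M → |a| < M → ∃ ρ : ℝ, Kerr.rMinus M a < ρ ∧ ρ < Kerr.rPlus M a ∧
      ∀ (k : ℕ) (β : ℝ), β < 2 → ∀ ε > (0 : ℝ), ∃ W η δ : ℝ, 0 < η ∧ 0 < δ ∧
        ∀ (𝓢 : Spacetime.{0} 4) (E : EndDatum 𝓢) (p : 𝓢.carrier),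
          IsHorizonHullElement 𝒟 Λ r₀ γ 𝓢 E p → IsExteriorWindowClose 𝓢 E M a W η δ →
            ∃ (𝓢' : Spacetime.{0} 4) (E' : EndDatum 𝓢') (p' : 𝓢'.carrier) (M' a' c : ℝ),
              IsHorizonHullElement 𝒟 Λ r₀ γ 𝓢' E' p' ∧ |M' - M| + |a' - a| ≤ ε ∧
                IsSlabClose 𝓢' E' M' a' ρ k β c ε ∧
                  ∀ M'' a'' : ℝ, IsKerrDoc 𝓢' E'.doc M'' a'' → IsKerrDoc 𝓢 E.doc M'' a'' := by
  intro M a hM ha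
  obtain ⟨ρ, hρ₁, hρ₂, h⟩ := hC2 M a hM ha
  refine ⟨ρ, hρ₁, hρ₂, fun k β hβ ε hε ↦ ?_⟩
  obtain ⟨W, η, δ, hη, hδ, h'⟩ := h k β hβ ε hε
  refine ⟨W, η, δ, hη, hδ, fun 𝓢 E p hZ hwin ↦ ?_⟩
  obtain ⟨𝓢', E', p', hZ', hcan, hup, hdown⟩ := hC1 𝓢 E p hZ
  obtain ⟨M', a', c, hnear, hslab⟩ := h' 𝓢' E' p' hZ' hcan (hup M a W η δ hwin)
  exact ⟨𝓢', E', p', M', a', c, hZ', hnear, hslab, hdown⟩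

omit [T2Space X] [SecondCountableTopology X] in
/-- **P′ ⇒ P″ along `γ`** (Reshape 2 WEAKENS the producer): if every window-close horizon-hull element is itself
slab-close (the wave-1 producer P′ along `γ`), it is its own representative and the transfer clause is the identity
(the cut with `Canon = ⊤` and the identity sibling). [cite: DafermosLuk2017, §1.2.1] -/
theorem hullNearKerrIsSlabClose_along_of_self {𝒟 : VacuumCauchyDevelopment D} [𝒟.metric.HasLeviCivita]
    {Λ : ℕ → ℝ≥0} {r₀ : ℝ} {γ : ℝ → 𝒟.carrier}
    (hP' : ∀ M a : ℝ, 0 < M → |a| < M → ∃ ρ : ℝ, Kerr.rMinus M a < ρ ∧ ρ < Kerr.rPlus M a ∧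
      ∀ (k : ℕ) (β : ℝ), β < 2 → ∀ ε > (0 : ℝ), ∃ W η δ : ℝ, 0 < η ∧ 0 < δ ∧
        ∀ (𝓢 : Spacetime.{0} 4) (E : EndDatum 𝓢) (p : 𝓢.carrier),
          IsHorizonHullElement 𝒟 Λ r₀ γ 𝓢 E p → IsExteriorWindowClose 𝓢 E M a W η δ →
            ∃ M' a' c : ℝ, |M' - M| + |a' - a| ≤ ε ∧ IsSlabClose 𝓢 E M' a' ρ k β c ε) :
    ∀ M a : ℝ, 0 < M → |a| < M → ∃ ρ : ℝ, Kerr.rMinus M a < ρ ∧ ρ < Kerr.rPlus M a ∧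
      ∀ (k : ℕ) (β : ℝ), β < 2 → ∀ ε > (0 : ℝ), ∃ W η δ : ℝ, 0 < η ∧ 0 < δ ∧
        ∀ (𝓢 : Spacetime.{0} 4) (E : EndDatum 𝓢) (p : 𝓢.carrier),
          IsHorizonHullElement 𝒟 Λ r₀ γ 𝓢 E p → IsExteriorWindowClose 𝓢 E M a W η δ →
            ∃ (𝓢' : Spacetime.{0} 4) (E' : EndDatum 𝓢') (p' : 𝓢'.carrier) (M' a' c : ℝ),
              IsHorizonHullElement 𝒟 Λ r₀ γ 𝓢' E' p' ∧ |M' - M| + |a' - a| ≤ ε ∧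
                IsSlabClose 𝓢' E' M' a' ρ k β c ε ∧
                  ∀ M'' a'' : ℝ, IsKerrDoc 𝓢' E'.doc M'' a'' → IsKerrDoc 𝓢 E.doc M'' a'' :=
  hullNearKerrIsSlabClose_along_of_canonical (fun _ _ _ ↦ True)
    (fun 𝓢 E p hZ ↦ ⟨𝓢, E, p, hZ, trivial, fun _ _ _ _ _ h ↦ h, fun _ _ h ↦ h⟩)
    fun M a hM ha ↦ by
      obtain ⟨ρ, hρ₁, hρ₂, h⟩ := hP' M a hM ha
      refine ⟨ρ, hρ₁, hρ₂, fun k β hβ ε hε ↦ ?_⟩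
      obtain ⟨W, η, δ, hη, hδ, h'⟩ := h k β hβ ε hε
      exact ⟨W, η, δ, hη, hδ, fun 𝓢' E' p' hZ' _ hwin ↦ h' 𝓢' E' p' hZ' hwin⟩

/-- **P″ (`stub_hullNearKerrIsSlabClose` after Reshape 2, verbatim conclusion) from its cut, over all developments.**
If every development as in Φ carries, for every class and every horizon generator path, SOME notion of canonical
based end satisfying C1 (canonical siblings with window-up / Kerr-doc-down transfer) and C2 (canonical window-close
elements are slab-close from an announced depth), then P″ holds. The two conjuncts are the typed halves of the
producer's honest content (C1: maximal limits along a subsequence + isometric embedding of siblings; C2: uniform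
pinned depth, red-shift / Cauchy stability of the collar, far alignment below `r⁻²`, interpolation against
all-orders tameness). [cite: DafermosLuk2017, §1.2.1] -/
theorem hullNearKerrIsSlabClose_of_canonical
    (hcut : ∀ (X : Type) [TopologicalSpace X] [ChartedSpace E3 X] [IsManifold (𝓡 3) ∞ X] [T2Space X]
      [SecondCountableTopology X] [ConnectedSpace X], ∀ D ∈ admissibleVacuumData X,
      ∀ (𝒟 : VacuumCauchyDevelopment D) [𝒟.metric.HasLeviCivita], DevHyp 𝒟 →
        ∀ (Λ : ℕ → ℝ≥0) (r₀ : ℝ) (γ : ℝ → 𝒟.carrier), IsHorizonPath 𝒟 γ →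
          ∃ Canon : ∀ 𝓢 : Spacetime.{0} 4, EndDatum 𝓢 → 𝓢.carrier → Prop,
            (∀ (𝓢 : Spacetime.{0} 4) (E : EndDatum 𝓢) (p : 𝓢.carrier), IsHorizonHullElement 𝒟 Λ r₀ γ 𝓢 E p →
              ∃ (𝓢' : Spacetime.{0} 4) (E' : EndDatum 𝓢') (p' : 𝓢'.carrier),
                IsHorizonHullElement 𝒟 Λ r₀ γ 𝓢' E' p' ∧ Canon 𝓢' E' p' ∧
                  (∀ M a W η δ : ℝ, IsExteriorWindowClose 𝓢 E M a W η δ →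
                    IsExteriorWindowClose 𝓢' E' M a W η δ) ∧
                    ∀ M'' a'' : ℝ, IsKerrDoc 𝓢' E'.doc M'' a'' → IsKerrDoc 𝓢 E.doc M'' a'') ∧
            ∀ M a : ℝ, 0 < M → |a| < M → ∃ ρ : ℝ, Kerr.rMinus M a < ρ ∧ ρ < Kerr.rPlus M a ∧
              ∀ (k : ℕ) (β : ℝ), β < 2 → ∀ ε > (0 : ℝ), ∃ W η δ : ℝ, 0 < η ∧ 0 < δ ∧
                ∀ (𝓢' : Spacetime.{0} 4) (E' : EndDatum 𝓢') (p' : 𝓢'.carrier),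
                  IsHorizonHullElement 𝒟 Λ r₀ γ 𝓢' E' p' → Canon 𝓢' E' p' →
                    IsExteriorWindowClose 𝓢' E' M a W η δ →
                      ∃ M' a' c : ℝ, |M' - M| + |a' - a| ≤ ε ∧ IsSlabClose 𝓢' E' M' a' ρ k β c ε) :
    ∀ (X : Type) [TopologicalSpace X] [ChartedSpace E3 X] [IsManifold (𝓡 3) ∞ X] [T2Space X]
      [SecondCountableTopology X] [ConnectedSpace X], ∀ D ∈ admissibleVacuumData X,
      ∀ (𝒟 : VacuumCauchyDevelopment D) [𝒟.metric.HasLeviCivita], DevHyp 𝒟 →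
        ∀ (Λ : ℕ → ℝ≥0) (r₀ : ℝ) (γ : ℝ → 𝒟.carrier), IsHorizonPath 𝒟 γ →
          ∀ M a : ℝ, 0 < M → |a| < M → ∃ ρ : ℝ, Kerr.rMinus M a < ρ ∧ ρ < Kerr.rPlus M a ∧
            ∀ (k : ℕ) (β : ℝ), β < 2 → ∀ ε > (0 : ℝ),
            ∃ W η δ : ℝ, 0 < η ∧ 0 < δ ∧
              ∀ (𝓢 : Spacetime.{0} 4) (E : EndDatum 𝓢) (p : 𝓢.carrier),
                IsHorizonHullElement 𝒟 Λ r₀ γ 𝓢 E p → IsExteriorWindowClose 𝓢 E M a W η δ →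
                  ∃ (𝓢' : Spacetime.{0} 4) (E' : EndDatum 𝓢') (p' : 𝓢'.carrier) (M' a' c : ℝ),
                    IsHorizonHullElement 𝒟 Λ r₀ γ 𝓢' E' p' ∧ |M' - M| + |a' - a| ≤ ε ∧
                      IsSlabClose 𝓢' E' M' a' ρ k β c ε ∧
                        ∀ M'' a'' : ℝ, IsKerrDoc 𝓢' E'.doc M'' a'' → IsKerrDoc 𝓢 E.doc M'' a'' := by
  intro X _ _ _ _ _ _ D hD 𝒟 _ hdev Λ r₀ γ hγ
  obtain ⟨Canon, hC1, hC2⟩ := hcut X D hD 𝒟 hdev Λ r₀ γ hγ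
  exact hullNearKerrIsSlabClose_along_of_canonical Canon hC1 hC2

/-- **Registered form (sub-goal `stub_hullNearKerrIsSlabClose_of_cut` of stmt-FinalStateConjecture-17430): the
registered producer P″ `stub_hullNearKerrIsSlabClose` (verbatim) follows from its cut C1 ∧ C2 over all developments.**
[cite: DafermosLuk2017, §1.2.1] -/
theorem stub_hullNearKerrIsSlabClose_of_cut : (∀ (X : Type) [TopologicalSpace X] [ChartedSpace E3 X] [IsManifold (𝓡 3) ∞ X] [T2Space X] [SecondCountableTopology X] [ConnectedSpace X], ∀ D ∈ admissibleVacuumData X, ∀ (𝒟 : VacuumCauchyDevelopment D) [𝒟.metric.HasLeviCivita], DevHyp 𝒟 → ∀ (Λ : ℕ → ℝ≥0) (r₀ : ℝ) (γ : ℝ → 𝒟.carrier), IsHorizonPath 𝒟 γ → ∃ Canon : ∀ 𝓢 : Spacetime.{0} 4, EndDatum 𝓢 → 𝓢.carrier → Prop, (∀ (𝓢 : Spacetime.{0} 4) (E : EndDatum 𝓢) (p : 𝓢.carrier), IsHorizonHullElement 𝒟 Λ r₀ γ 𝓢 E p → ∃ (𝓢' : Spacetime.{0} 4) (E' : EndDatum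 𝓢') (p' : 𝓢'.carrier), IsHorizonHullElement 𝒟 Λ r₀ γ 𝓢' E' p' ∧ Canon 𝓢' E' p' ∧ (∀ M a W η δ : ℝ, IsExteriorWindowClose 𝓢 E M a W η δ → IsExteriorWindowClose 𝓢' E' M a W η δ) ∧ ∀ M'' a'' : ℝ, IsKerrDoc 𝓢' E'.doc M'' a'' → IsKerrDoc 𝓢 E.doc M'' a'') ∧ ∀ M a : ℝ, 0 < M → |a| < M → ∃ ρ : ℝ, Kerr.rMinus M a < ρ ∧ ρ < Kerr.rPlus M a ∧ ∀ (k : ℕ) (β : ℝ), β < 2 → ∀ ε > (0 : ℝ), ∃ W η δ : ℝ, 0 < η ∧ 0 < δ ∧ ∀ (𝓢' : Spacetime.{0} 4) (E' : EndDatum 𝓢') (p' : 𝓢'.carrier), IsHorizonHullElement 𝒟 Λ r₀ γ 𝓢' E' p' → Canon 𝓢' E' p' → IsExteriorWindowClose 𝓢' E' M a W η δ → ∃ M' a' c : ℝ, |M' - M| + |a' - a| ≤ ε ∧ IsSlabClose 𝓢' E' M' a' ρ k β c ε) → ∀ (X : Type) [TopologicalSpace X] [ChartedSpace E3 X] [IsManifold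 (𝓡 3) ∞ X] [T2Space X] [SecondCountableTopology X] [ConnectedSpace X], ∀ D ∈ admissibleVacuumData X, ∀ (𝒟 : VacuumCauchyDevelopment D) [𝒟.metric.HasLeviCivita], DevHyp 𝒟 → ∀ (Λ : ℕ → ℝ≥0) (r₀ : ℝ) (γ : ℝ → 𝒟.carrier), IsHorizonPath 𝒟 γ → ∀ M a : ℝ, 0 < M → |a| < M → ∃ ρ : ℝ, Kerr.rMinus M a < ρ ∧ ρ < Kerr.rPlus M a ∧ ∀ (k : ℕ) (β : ℝ), β < 2 → ∀ ε > (0 : ℝ), ∃ W η δ : ℝ, 0 < η ∧ 0 < δ ∧ ∀ (𝓢 : Spacetime.{0} 4) (E : EndDatum 𝓢) (p : 𝓢.carrier), IsHorizonHullElement 𝒟 Λ r₀ γ 𝓢 E p → IsExteriorWindowClose 𝓢 E M a W η δ → ∃ (𝓢' : Spacetime.{0} 4) (E' : EndDatum 𝓢') (p' : 𝓢'.carrier) (M' a' c : ℝ), IsHorizonHullElement 𝒟 Λ r₀ γ 𝓢' E' p' ∧ |M' - M| + |a' - a| ≤ ε ∧ IsSlabClose 𝓢' E' M' a' ρ k β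 c ε ∧ ∀ M'' a'' : ℝ, IsKerrDoc 𝓢' E'.doc M'' a'' → IsKerrDoc 𝓢 E.doc M'' a'' :=
  hullNearKerrIsSlabClose_of_canonical

end Cut

/-! ### §3 The class relaxation P‴: the producer announces the class of its representative -/

section Relaxed

variable {X : Type} [TopologicalSpace X] [ChartedSpace E3 X] [IsManifold (𝓡 3) ∞ X]
  [T2Space X] [SecondCountableTopology X] [ConnectedSpace X] {D : InitialDataSet (𝓡 3) X}

omit [T2Space X] [SecondCountableTopology X] in
/-- **P″ ⇒ P‴ along `γ`.** The relaxed producer P‴ lets the representative live in a class `(Λ', r₀')` ANNOUNCED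
by the producer together with the depth `ρ` (depending on the development, `(Λ, r₀)`, `γ`, `(M, a)` only); P″ is
the case `(Λ', r₀') = (Λ, r₀)`. The bridge B′ is stated for every class, so `P‴ ∘ B′` gives window isolation
along generators by the same logic as `P″ ∘ B′` (the class of the representative is fed to B′). [cite: DafermosLuk2017, §1.2.1] -/
theorem hullNearKerrIsSlabClose_relaxed_of {𝒟 : VacuumCauchyDevelopment D} [𝒟.metric.HasLeviCivita]
    {Λ : ℕ → ℝ≥0} {r₀ : ℝ} {γ : ℝ → 𝒟.carrier}
    (hP : ∀ M a : ℝ, 0 < M → |a| < M → ∃ ρ : ℝ, Kerr.rMinus M a < ρ ∧ ρ < Kerr.rPlus M a ∧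
      ∀ (k : ℕ) (β : ℝ), β < 2 → ∀ ε > (0 : ℝ), ∃ W η δ : ℝ, 0 < η ∧ 0 < δ ∧
        ∀ (𝓢 : Spacetime.{0} 4) (E : EndDatum 𝓢) (p : 𝓢.carrier),
          IsHorizonHullElement 𝒟 Λ r₀ γ 𝓢 E p → IsExteriorWindowClose 𝓢 E M a W η δ →
            ∃ (𝓢' : Spacetime.{0} 4) (E' : EndDatum 𝓢') (p' : 𝓢'.carrier) (M' a' c : ℝ),
              IsHorizonHullElement 𝒟 Λ r₀ γ 𝓢' E' p' ∧ |M' - M| + |a' - a| ≤ ε ∧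
                IsSlabClose 𝓢' E' M' a' ρ k β c ε ∧
                  ∀ M'' a'' : ℝ, IsKerrDoc 𝓢' E'.doc M'' a'' → IsKerrDoc 𝓢 E.doc M'' a'') :
    ∀ M a : ℝ, 0 < M → |a| < M → ∃ (ρ : ℝ) (Λ' : ℕ → ℝ≥0) (r₀' : ℝ), Kerr.rMinus M a < ρ ∧ ρ < Kerr.rPlus M a ∧
      ∀ (k : ℕ) (β : ℝ), β < 2 → ∀ ε > (0 : ℝ), ∃ W η δ : ℝ, 0 < η ∧ 0 < δ ∧
        ∀ (𝓢 : Spacetime.{0} 4) (E : EndDatum 𝓢) (p : 𝓢.carrier),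
          IsHorizonHullElement 𝒟 Λ r₀ γ 𝓢 E p → IsExteriorWindowClose 𝓢 E M a W η δ →
            ∃ (𝓢' : Spacetime.{0} 4) (E' : EndDatum 𝓢') (p' : 𝓢'.carrier) (M' a' c : ℝ),
              IsHorizonHullElement 𝒟 Λ' r₀' γ 𝓢' E' p' ∧ |M' - M| + |a' - a| ≤ ε ∧
                IsSlabClose 𝓢' E' M' a' ρ k β c ε ∧
                  ∀ M'' a'' : ℝ, IsKerrDoc 𝓢' E'.doc M'' a'' → IsKerrDoc 𝓢 E.doc M'' a'' := by
  intro M a hM ha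
  obtain ⟨ρ, hρ₁, hρ₂, h⟩ := hP M a hM ha
  exact ⟨ρ, Λ, r₀, hρ₁, hρ₂, h⟩

omit [T2Space X] [SecondCountableTopology X] in
/-- **P‴ along `γ` from its cut C1‴ ∧ C2‴** (pure logic): as `hullNearKerrIsSlabClose_along_of_canonical`, but the
canonical sibling of a class-`(Λ, r₀)` input lives in the PRODUCER's class `(Λ', r₀')` (announced with `ρ`), and
C2‴ is slab-closeness of canonical class-`(Λ', r₀')` elements. This is the robust form: the input's class only
guarantees the input's own pinned collar; the representative's clock and far chart (hence its ball constants at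
every order) are the producer's, not won in a game against the input's accidental end structure. [cite: DafermosLuk2017, §1.2.1] -/
theorem hullNearKerrIsSlabClose_relaxed_along_of_canonical {𝒟 : VacuumCauchyDevelopment D}
    [𝒟.metric.HasLeviCivita] {Λ : ℕ → ℝ≥0} {r₀ : ℝ} {γ : ℝ → 𝒟.carrier}
    (Canon : ∀ 𝓢 : Spacetime.{0} 4, EndDatum 𝓢 → 𝓢.carrier → Prop) (Λ' : ℕ → ℝ≥0) (r₀' : ℝ)
    (hC1 : ∀ (𝓢 : Spacetime.{0} 4) (E : EndDatum 𝓢) (p : 𝓢.carrier), IsHorizonHullElement 𝒟 Λ r₀ γ 𝓢 E p →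
      ∃ (𝓢' : Spacetime.{0} 4) (E' : EndDatum 𝓢') (p' : 𝓢'.carrier),
        IsHorizonHullElement 𝒟 Λ' r₀' γ 𝓢' E' p' ∧ Canon 𝓢' E' p' ∧
          (∀ M a W η δ : ℝ, IsExteriorWindowClose 𝓢 E M a W η δ → IsExteriorWindowClose 𝓢' E' M a W η δ) ∧
            ∀ M'' a'' : ℝ, IsKerrDoc 𝓢' E'.doc M'' a'' → IsKerrDoc 𝓢 E.doc M'' a'')
    (hC2 : ∀ M a : ℝ, 0 < M → |a| < M → ∃ ρ : ℝ, Kerr.rMinus M a < ρ ∧ ρ < Kerr.rPlus M a ∧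
      ∀ (k : ℕ) (β : ℝ), β < 2 → ∀ ε > (0 : ℝ), ∃ W η δ : ℝ, 0 < η ∧ 0 < δ ∧
        ∀ (𝓢' : Spacetime.{0} 4) (E' : EndDatum 𝓢') (p' : 𝓢'.carrier),
          IsHorizonHullElement 𝒟 Λ' r₀' γ 𝓢' E' p' → Canon 𝓢' E' p' → IsExteriorWindowClose 𝓢' E' M a W η δ →
            ∃ M' a' c : ℝ, |M' - M| + |a' - a| ≤ ε ∧ IsSlabClose 𝓢' E' M' a' ρ k β c ε) :
    ∀ M a : ℝ, 0 < M → |a| < M → ∃ (ρ : ℝ) (Λ' : ℕ → ℝ≥0) (r₀' : ℝ), Kerr.rMinus M a < ρ ∧ ρ < Kerr.rPlus M a ∧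
      ∀ (k : ℕ) (β : ℝ), β < 2 → ∀ ε > (0 : ℝ), ∃ W η δ : ℝ, 0 < η ∧ 0 < δ ∧
        ∀ (𝓢 : Spacetime.{0} 4) (E : EndDatum 𝓢) (p : 𝓢.carrier),
          IsHorizonHullElement 𝒟 Λ r₀ γ 𝓢 E p → IsExteriorWindowClose 𝓢 E M a W η δ →
            ∃ (𝓢' : Spacetime.{0} 4) (E' : EndDatum 𝓢') (p' : 𝓢'.carrier) (M' a' c : ℝ),
              IsHorizonHullElement 𝒟 Λ' r₀' γ 𝓢' E' p' ∧ |M' - M| + |a' - a| ≤ ε ∧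
                IsSlabClose 𝓢' E' M' a' ρ k β c ε ∧
                  ∀ M'' a'' : ℝ, IsKerrDoc 𝓢' E'.doc M'' a'' → IsKerrDoc 𝓢 E.doc M'' a'' := by
  intro M a hM ha
  obtain ⟨ρ, hρ₁, hρ₂, h⟩ := hC2 M a hM ha
  refine ⟨ρ, Λ', r₀', hρ₁, hρ₂, fun k β hβ ε hε ↦ ?_⟩
  obtain ⟨W, η, δ, hη, hδ, h'⟩ := h k β hβ ε hε
  refine ⟨W, η, δ, hη, hδ, fun 𝓢 E p hZ hwin ↦ ?_⟩
  obtain ⟨𝓢', E', p', hZ', hcan, hup, hdown⟩ := hC1 𝓢 E p hZ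
  obtain ⟨M', a', c, hnear, hslab⟩ := h' 𝓢' E' p' hZ' hcan (hup M a W η δ hwin)
  exact ⟨𝓢', E', p', M', a', c, hZ', hnear, hslab, hdown⟩

end Relaxed

end Summit.FinalStateConjecture.FinalStateConjecture.Theorems.DarkFuture

end
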